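import Mathlib
import HarnessLib
import Summits.HubbardSuperconductivity.HubbardSuperconductivity.Theorems.KLProgrammeKLRegimeEngineV8DefsU7
import Summits.HubbardSuperconductivity.HubbardSuperconductivity.Theorems.KLProgrammeKLRegimeEngineV8TwoLegGridMomentsFrameBaseTime
import Summits.HubbardSuperconductivity.HubbardSuperconductivity.Theorems.KLProgrammeKLRegimeEngineV8TwoLegGridMomentsFrameBaseMixed

/-!
# Route `KLProgramme` — ENGINE child gen 8 (stmt-HubbardSuperconductivity-20437 `KLRegimeEngineV17F2`), class #7 in GRID currency, located risk #9
# RESOLVED-ELECT (T′-B) (pen (R60g)): the scale-0 frame-`K` base rows BY NAME at the decay literal `a := klE3A1 R` — the frame part of p3's decay constant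
# `A(R,U,Nsc)` is absorbed by `klE3A1`'s slack `((Nsc+1)U² + 2|U|) ≤ 3` at regime depth, so the (T′-B) literals of the n = 0 base are CLOSED `R`-TERMS:
# `Zt⁽⁰⁾ = 4e²A²·klE3A1 R`, `Zs₂⁽⁰⁾ = 8e²A²·klE3A1 R`, `Zs₁⁽⁰⁾ = 256e⁶A·m_R·klE3A1 R` (`A = 4e⁴κ_R + 16e⁸κ₀²`) — the class-#7 owner's input for `klZs1`/`klZt`/`klZs2` vs `klC2tG`/`klC2sG`

Cell gate-hubbard-kl, seat hubbard-kl-k3c2-p1 g8 (row «scale-0 Gram step»).  `klE3A1 R` (…EngineV8DefsU7, r2d-p1's frame-zero literal) is p3's weighted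
decay constant with the `U`-factor `((0+1)U² + 2|U|)` replaced by `3`; at an admissible frame of depth `Nsc` the same expression carries
`((Nsc+1)U² + 2|U|)`, which is `≤ 3` as soon as `(Nsc+1)U² ≤ 1` and `|U| ≤ 1` — at regime depth `(nScales β+1)U² ≤ c/log 4 ≤ 2⁻¹²⁰`
(`nScales_succ_mul_sq_le`).  So NO new decay literal is needed for the frame-`K` base:

* §1 **`frameAlpha_le_klE3A1`** — `A(R,U,Nsc) ≤ klE3A1 R` for `|U| ≤ 1`, `(Nsc+1)·U² ≤ 1` (general-depth twin of `bareAlphaOne_le_klE3A1`);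
* §2 the three rows at `a := klE3A1 R`: **`twoLegGrid_time_row_scaleZero_of_frameOK_klE3A1`** (pure `U²`: `≤ 4e²·klE3A1·A²·U²·β/(2N)`, smallness
  `e·klE3A1·|U|·A ≤ 1/2`), **`twoLegGrid_space_row_scaleZero_of_frameOK_mixed_klE3A1`** (mixed: `≤ (8e²A²·U² + 256e⁶A·m_R·(Nsc+1)U²·|U|)·klE3A1·β/(2N)`,
  smallness `2e·klE3A1·A·|U| ≤ 1/2`) — binders `FrameOK R U Nsc μ K`, `R.WF`, `0 < U`, `|U| ≤ 1`, `(Nsc+1)U² ≤ 1`, `klBetaMin ≤ β`, `klEngL₃/M₃`.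

Proofs only; no definitions; nothing about the model's sizes is asserted; nothing asserts superconductivity.  `--supports stmt-HubbardSuperconductivity-20437`.
References: BGM 2006 §3 (3.2)–(3.8) [cite: BenfattoGiulianiMastropietro2006]; Pedra–Salmhofer 2008 Thm 2.4 [cite: PedraSalmhofer2008].
-/

noncomputable section

namespace Summit.HubbardSuperconductivity.HubbardSuperconductivity.Theorems.EngineV8

set_option linter.dupNamespace false -- summit = problem name (single-conjunct summit), D-0017

open Real Finset Literature.MathematicalPhysics.QuantumLattice Literature.Probability.LatticeModels
open Literature.Probability.LatticeModels.BattleFederbush GrassmannAlgebra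
open Summit.HubbardSuperconductivity.HubbardSuperconductivity.Theorems.KLRegimeSplit
open Summit.HubbardSuperconductivity.HubbardSuperconductivity.Theorems.KLProgrammeLegKernels

/-! ## §1 The frame-`K` decay constant fits under `klE3A1 R` at regime depth -/

/-- **`A(R,U,Nsc) ≤ klE3A1 R`** for `|U| ≤ 1` and `(Nsc+1)·U² ≤ 1` (then `(Nsc+1)U² + 2|U| ≤ 3`, `klE3A1`'s slack). -/
theorem frameAlpha_le_klE3A1 (R : RenConsts) {U : ℝ} (hU1 : |U| ≤ 1) {Nsc : ℕ} (hN : ((Nsc : ℝ) + 1) * U ^ 2 ≤ 1) :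
    klScaleZeroA0 + uvTimeMomentConst klE0 7 32 +
          2 * (uvSpaceMomentConst klE0 1 (uvPieceSq klE0 (uvBaseQ klCutoffX5 klE0 4) (uvBaseQ' klCutoffX5 klE0 4)) +
            (1 / 4 * Real.sqrt (216 * (1 / klE0 + 1 / 2)) *
                ∑ e : Fin 2 × Fin 2, (uvLinV klE0 (1 + (e.1 : ℕ) + (e.2 : ℕ)) *
                    (klCutoffX5 * ((1 + ((e.1 : ℕ) + (e.2 : ℕ)) + 2).factorial : ℝ) * (4 / klE0) ^ (1 + ((e.1 : ℕ) + (e.2 : ℕ)) + 1)) +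
                  uvLinD klE0 (1 + (e.1 : ℕ) + (e.2 : ℕ)) *
                    (klCutoffX5 * ((1 + ((e.1 : ℕ) + (e.2 : ℕ)) + 3).factorial : ℝ) * (4 / klE0) ^ (1 + ((e.1 : ℕ) + (e.2 : ℕ)) + 2)))) *
              (4608 * (1 + R.Gfr 0 + R.Gfr 1 + R.Gfr 2 + R.Gfr 3) ^ 4 * (((Nsc : ℝ) + 1) * U ^ 2 + 2 * |U|))) ≤ klE3A1 R := by
  have h3 := klE3Y_nonneg
  have hfac : ((Nsc : ℝ) + 1) * U ^ 2 + 2 * |U| ≤ 3 := by linarith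
  have hG : 0 ≤ 4608 * (1 + R.Gfr 0 + R.Gfr 1 + R.Gfr 2 + R.Gfr 3) ^ 4 := by positivity
  have hkey : 4608 * (1 + R.Gfr 0 + R.Gfr 1 + R.Gfr 2 + R.Gfr 3) ^ 4 * (((Nsc : ℝ) + 1) * U ^ 2 + 2 * |U|) ≤
      4608 * (1 + R.Gfr 0 + R.Gfr 1 + R.Gfr 2 + R.Gfr 3) ^ 4 * 3 := mul_le_mul_of_nonneg_left hfac hG
  have hmono := mul_le_mul_of_nonneg_left hkey h3
  unfold klE3A1
  linarith [hmono]

/-! ## §2 The frame-`K` base rows at `a := klE3A1 R` -/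

section FrameBaseKlE3A1

variable {L M : ℕ} [NeZero L] [NeZero M] {R : RenConsts} {μ U β : ℝ} {Nsc : ℕ} {K : TrigPolyC4v}

/-- **TIME row at `a := klE3A1 R`** (pure `U²`): `FrameOK R U Nsc μ K`, `R.WF`, `0 < U`, `|U| ≤ 1`, `(Nsc+1)U² ≤ 1`, `klBetaMin ≤ β`, thresholds,
smallness `e·klE3A1 R·|U|·(4e⁴κ_R + 16e⁸κ₀²) ≤ 1/2` ⇒ time row `≤ 4e²·klE3A1 R·(4e⁴κ_R + 16e⁸κ₀²)²·U²·β/(2N)`. -/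
theorem twoLegGrid_time_row_scaleZero_of_frameOK_klE3A1 (hK : FrameOK R U Nsc μ K) (hR : R.WF) (hU : 0 < U) (hU1 : |U| ≤ 1)
    (hN : ((Nsc : ℝ) + 1) * U ^ 2 ≤ 1) (hβ : klBetaMin ≤ β) (hL : klEngL₃ β U ≤ L) (hM : klEngM₃ β U L ≤ M)
    (hsmall : Real.exp 1 * klE3A1 R * |U| *
      (4 * Real.exp 1 ^ 4 * (256 * ((4 / 3) * Real.sqrt (24 * π ^ 2 * (R.Gfr 0 + 1) * (R.Gfr 2 + 1)) + (128 / 15) * (R.Gfr 0 + 1))) +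
        16 * Real.exp 1 ^ 8 * Real.sqrt (2 * (7 + 1606732)) ^ 2) ≤ 1 / 2)
    (σ : Fin 2) (p₀ : GridPoint L (2 * (2 * M))) :
    ∑ p₁ : GridPoint L (2 * (2 * M)),
      β / ((2 * (2 * M) : ℕ) : ℝ) * (circDist (2 * (2 * M)) p₀.1.val p₁.1.val : ℝ) *
        ‖kernel ℂ
          (effAction ℂ ((hubbardGridSub L M β (2 * (2 * M))).transpose *
              hubbardCovAboveCT L M β μ 0 K (klScale klE0 0) * hubbardGridSub L M β (2 * (2 * M)))
            (hubbardGridInteraction L (2 * (2 * M)) β U + hubbardGridCounterQuadratic L (2 * (2 * M)) β K) -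
            hubbardGridCounterQuadratic L (2 * (2 * M)) β K) 2
          (fun i => ((![p₀, p₁] i, σ), i))‖ ≤
      4 * Real.exp 1 ^ 2 * klE3A1 R *
        (4 * Real.exp 1 ^ 4 * (256 * ((4 / 3) * Real.sqrt (24 * π ^ 2 * (R.Gfr 0 + 1) * (R.Gfr 2 + 1)) + (128 / 15) * (R.Gfr 0 + 1))) +
          16 * Real.exp 1 ^ 8 * Real.sqrt (2 * (7 + 1606732)) ^ 2) ^ 2 * U ^ 2 * (β / (2 * ((2 * (2 * M) : ℕ) : ℝ))) :=
  twoLegGrid_time_row_scaleZero_of_frameOK hK hR hU hU1 hβ hL hM (klE3A1_pos R) (frameAlpha_le_klE3A1 R hU1 hN) hsmall σ p₀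

/-- **SPACE row at `a := klE3A1 R`, mixed currency** (check (i′)): same binders, smallness `2e·klE3A1 R·(4e⁴κ_R + 16e⁸κ₀²)·|U| ≤ 1/2` ⇒ space row
`≤ (8e²(4e⁴κ_R+16e⁸κ₀²)²·U² + 256e⁶(4e⁴κ_R+16e⁸κ₀²)·m_R·((Nsc+1)U²)·|U|)·klE3A1 R·β/(2N)`. -/
theorem twoLegGrid_space_row_scaleZero_of_frameOK_mixed_klE3A1 (hK : FrameOK R U Nsc μ K) (hR : R.WF) (hU : 0 < U) (hU1 : |U| ≤ 1)
    (hN : ((Nsc : ℝ) + 1) * U ^ 2 ≤ 1) (hβ : klBetaMin ≤ β) (hL : klEngL₃ β U ≤ L) (hM : klEngM₃ β U L ≤ M)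
    (hsmall : 2 * Real.exp 1 * klE3A1 R *
      (4 * Real.exp 1 ^ 4 * (256 * ((4 / 3) * Real.sqrt (24 * π ^ 2 * (R.Gfr 0 + 1) * (R.Gfr 2 + 1)) + (128 / 15) * (R.Gfr 0 + 1))) +
        16 * Real.exp 1 ^ 8 * Real.sqrt (2 * (7 + 1606732)) ^ 2) * |U| ≤ 1 / 2)
    (σ : Fin 2) (p₀ : GridPoint L (2 * (2 * M))) :
    ∑ p₁ : GridPoint L (2 * (2 * M)),
      (if p₁.2 - p₀.2 = 0 then (0 : ℝ) else
        (1 + (((p₁.2 - p₀.2) 0).valMinAbs.natAbs : ℝ) + (((p₁.2 - p₀.2) 1).valMinAbs.natAbs : ℝ))) *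
        ‖kernel ℂ
          (effAction ℂ ((hubbardGridSub L M β (2 * (2 * M))).transpose *
              hubbardCovAboveCT L M β μ 0 K (klScale klE0 0) * hubbardGridSub L M β (2 * (2 * M)))
            (hubbardGridInteraction L (2 * (2 * M)) β U + hubbardGridCounterQuadratic L (2 * (2 * M)) β K) -
            hubbardGridCounterQuadratic L (2 * (2 * M)) β K) 2
          (fun i => ((![p₀, p₁] i, σ), i))‖ ≤
      (8 * Real.exp 1 ^ 2 *
          (4 * Real.exp 1 ^ 4 * (256 * ((4 / 3) * Real.sqrt (24 * π ^ 2 * (R.Gfr 0 + 1) * (R.Gfr 2 + 1)) + (128 / 15) * (R.Gfr 0 + 1))) +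
            16 * Real.exp 1 ^ 8 * Real.sqrt (2 * (7 + 1606732)) ^ 2) ^ 2 * U ^ 2 +
        256 * Real.exp 1 ^ 6 *
          (4 * Real.exp 1 ^ 4 * (256 * ((4 / 3) * Real.sqrt (24 * π ^ 2 * (R.Gfr 0 + 1) * (R.Gfr 2 + 1)) + (128 / 15) * (R.Gfr 0 + 1))) +
            16 * Real.exp 1 ^ 8 * Real.sqrt (2 * (7 + 1606732)) ^ 2) *
          (6 * (Real.pi * R.Gfr 1 / 2 + Real.pi ^ 2 * R.Gfr 2 / (2 * Real.sqrt 2) + Real.pi ^ 3 * R.Gfr 3 / 8)) * (((Nsc : ℝ) + 1) * U ^ 2) * |U|) *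
        klE3A1 R * (β / (2 * ((2 * (2 * M) : ℕ) : ℝ))) :=
  twoLegGrid_space_row_scaleZero_of_frameOK_mixed hK hR hU hU1 hβ hL hM (klE3A1_pos R) (frameAlpha_le_klE3A1 R hU1 hN) hsmall σ p₀

end FrameBaseKlE3A1

end Summit.HubbardSuperconductivity.HubbardSuperconductivity.Theorems.EngineV8

end
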